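import Summits.KontsevichZagierPeriods.KontsevichZagierPeriods.Theses.TerasomaMultiplication
import Summits.KontsevichZagierPeriods.KontsevichZagierPeriods.Theorems.TerasomaMultiplicationGammaHodgeFromRelatorsChains
import Summits.KontsevichZagierPeriods.KontsevichZagierPeriods.Theorems.TerasomaMultiplicationGammaHodgeSectorStubProducts
import Summits.KontsevichZagierPeriods.KontsevichZagierPeriods.Theorems.DasGapTwelve.Negative.LoadBearing

/-!
# `GammaHodgeFromRelators` (stmt-KontsevichZagierPeriods-14947, route TerasomaMultiplication) —
the relator compiler (glue)

The item: `MultiplicationAccessible → BetaCancellation → DasGapTwelve → GapSectorBeyondTwelve →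
(Euler reflection at rational arguments) → GammaHodgeSector`.

Proof. Given Γ-Hodge data `(x, y; x', y'; k; c)` and the pinned representations `r` (cube) and
`r'` (`2k`-ball × cube), let `D := wordSym x y − wordSym x' y' − k·[½,½] ∈ BSym = ℤ[ℚ × ℚ]`.
* If `D ∉ RelSpan ⊔ ℤ·g₁₂` (`g₁₂ = [1/12,1/4] − [1/4,1/4]`), the conclusion is the hypothesis
  `GapSectorBeyondTwelve` verbatim (its inline closure term IS `RelSpan ⊔ ℤ·g₁₂`).
* If `D ∈ RelSpan ⊔ ℤ·g₁₂`, work in the formal period ring `P = FormalRep ⧸ relations`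
  (`KZ.FormalPeriodRing`): Beta classes are non-zero-divisors of `P` under `BetaCancellation`, so
  (REALISATION, `realisation_of`, the fraction-field argument of the `GammaHodgeSector` line
  `koblitz-ogus-halving`, here over an arbitrary set of relator pairs) symbol congruence modulo the
  span of pairs `(L, R)` with `Π β(L) = κ(q)·Π β(R)` in `P` (`q > 0` real algebraic) gives
  `Π β(W) = κ(q)·Π β(W' ⊎ {(½,½)}^k)` in `P`. The standard pairs hold in `P` by the relator chains
  (symmetry, translation, Dirichlet, unit: rules 1–3; Gauss multiplication: `MultiplicationAccessible`;
  reflection: the Euler hypothesis), and the extra pair `g₁₂` by `DasGapTwelve`. With the product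
  bookkeeping `⟦r⟧ = Π β(W)`, `⟦r'⟧ = κ(c)·β(½,½)^k·Π β(W')`, evaluation (`KZ.evalP`, soundness)
  and `r.value = r'.value` force `q = c`, so `⟦r⟧ = ⟦r'⟧`, i.e. `r ∼ r'`.

Layout: the one/two-letter relator chains in `P` (symmetry, unit, translation, Dirichlet,
reflection) are `…GammaHodgeFromRelatorsChains.lean`; the product bookkeeping (cube classes, the
`2k`-ball × cube class with `k!·⟦B_{2k}⟧ = β(½,½)^k`, and Gauss multiplication in `P` from the crux
`MultiplicationAccessible`) is the landed stub `GammaHodgeSectorKO.stub_products` of the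
`GammaHodgeSector` line (`…GammaHodgeSectorStubProducts.lean`, over the Literature chains
`KZ.cubeBetaRep_toFormalPeriod_eq_prod`, `KZ.dirichletRep_toFormalPeriod_eq_prod`,
`KZ.gaussMultiplication_toFormalPeriod` of `KZGaussMultiplicationChain.lean` and
`KZ.BallPeeling.factorial_mul_toFormalPeriod_ball` of `KZBallVolume.lean`); this file holds the
realisation, the `g₁₂` pair, the compiler `gammaHodgeFromRelators_of` and the closing theorem
`gammaHodgeFromRelators_proof`.

References: Kontsevich–Zagier 2001 §1.1–1.2, §4.1; Andrews–Askey–Roy 1999 Thm 1.8.1;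
Deligne LNM 900 §7 (Koblitz–Ogus appendix).
-/

noncomputable section

open MeasureTheory Set
open scoped BigOperators

namespace Summit.KontsevichZagierPeriods.TerasomaMultiplication.GammaHodgeFromRelators

open Literature.NumberTheory.Transcendental
open Literature.NumberTheory.Transcendental.KZ
open Literature.NumberTheory.Transcendental.BetaSymbol
open Summit.KontsevichZagierPeriods.GammaHodgeSectorKO
open Summit.KontsevichZagierPeriods.GammaHodgeSectorNegative (IsCubeBetaRep IsBallCubeRep)
open Summit.KontsevichZagierPeriods.KontsevichZagierPeriods.BetaCancellationNegative
  (betaKernel mem_unitIoo)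
open Summit.KontsevichZagierPeriods.KontsevichZagierPeriods.Theses.TerasomaMultiplication
  (MultiplicationAccessible BetaCancellation DasGapTwelve GapSectorBeyondTwelve GammaHodgeSector
   GammaHodgeFromRelators)
open Summit.KontsevichZagierPeriods.KontsevichZagierPeriods.Theses.CompiledSubstitutions
  (EulerReflectionRational)
open Summit.KontsevichZagierPeriods.TerasomaMultiplication.DasGapTwelveNegative (c₀ c₀_pos isAlgebraic_c₀)

/-! ## §1 Realisation over an arbitrary set of relator pairs -/

/-- **Realisation** (generalised from the `koblitz-ogus-halving` line of `GammaHodgeSector`): if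
every pair `(L, R) ∈ S` holds in `P` up to a positive algebraic constant and Beta classes cancel
(`BetaCancellation`), then two Beta words whose symbols are congruent modulo the span of
`{sym L − sym R | (L,R) ∈ S}` have classes that agree up to a positive algebraic constant. Beta
classes are non-zero-divisors, hence units of `Frac P ⊇ P`; the symbol map lifts to
`BSym → (Frac P)ˣ` and sends the span into the constants `κ(q)`. [folklore] -/
theorem realisation_of (hB : BetaCancellation) (S : Set (Multiset (ℚ × ℚ) × Multiset (ℚ × ℚ)))
    (hrel : ∀ p ∈ S, IsConstMultiple (prodClass p.1) (prodClass p.2))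
    (m₁ m₂ : Multiset (ℚ × ℚ))
    (h : msym m₁ - msym m₂ ∈ AddSubgroup.closure ((fun p => msym p.1 - msym p.2) '' S)) :
    IsConstMultiple (prodClass m₁) (prodClass m₂) := by
  -- adapted from `GammaHodgeSectorKO.stub_realisation` (same tree), `relatorPairs ↦ S`
  set L : Type := FractionRing FormalPeriodRing
  set ι : FormalPeriodRing →+* L := algebraMap FormalPeriodRing L
  have hι : Function.Injective ι := IsFractionRing.injective FormalPeriodRing L
  have hunit : ∀ ab : ℚ × ℚ, IsUnit (ι (betaClass ab.1 ab.2)) := fun ab =>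
    IsLocalization.map_units L ⟨betaClass ab.1 ab.2, betaClass_mem_nonZeroDivisors hB ab.1 ab.2⟩
  obtain ⟨Φ, hΦof⟩ : ∃ Φ : BSym →+ Additive Lˣ,
      ∀ ab : ℚ × ℚ, Φ (bsym ab.1 ab.2) = Additive.ofMul (hunit ab).unit :=
    ⟨FreeAbelianGroup.lift fun ab => Additive.ofMul (hunit ab).unit,
      fun ab => FreeAbelianGroup.lift_apply_of _ _⟩
  have hΦ : ∀ m : Multiset (ℚ × ℚ), ((Additive.toMul (Φ (msym m)) : Lˣ) : L) = ι (prodClass m) := by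
    intro m
    induction m using Multiset.induction_on with
    | empty => rw [msym_zero, map_zero, toMul_zero, Units.val_one, prodClass_zero, map_one]
    | cons p m ih =>
      rw [msym_cons, map_add, toMul_add, Units.val_mul, ih, prodClass_cons, map_mul,
        hΦof (p.1, p.2), toMul_ofMul, IsUnit.unit_spec]
  have key : ∀ v ∈ AddSubgroup.closure ((fun p => msym p.1 - msym p.2) '' S),
      ∃ (q : ℝ) (hq : IsAlgebraic ℚ q), 0 < q ∧
      ((Additive.toMul (Φ v) : Lˣ) : L) = ι (kap q hq) := by
    intro v hv
    induction hv using AddSubgroup.closure_induction with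
    | mem v hv =>
      obtain ⟨⟨Lw, Rw⟩, hLR, rfl⟩ := hv
      obtain ⟨q, hq, hq0, hEq⟩ := hrel _ hLR
      refine ⟨q, hq, hq0, ?_⟩
      rw [map_sub, toMul_sub, div_eq_mul_inv, Units.val_mul, hΦ, hEq, map_mul, mul_assoc,
        ← hΦ Rw, Units.mul_inv, mul_one]
    | zero =>
      exact ⟨1, isAlgebraic_one, one_pos, by
        rw [map_zero, toMul_zero, Units.val_one, kap_one, map_one]⟩
    | add v w _ _ ihv ihw =>
      obtain ⟨q₁, hq₁, h₁, e₁⟩ := ihv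
      obtain ⟨q₂, hq₂, h₂, e₂⟩ := ihw
      exact ⟨q₁ * q₂, hq₁.mul hq₂, mul_pos h₁ h₂, by
        rw [map_add, toMul_add, Units.val_mul, e₁, e₂, kap_mul, map_mul]⟩
    | neg v _ ih =>
      obtain ⟨q, hq, h0, e⟩ := ih
      refine ⟨q⁻¹, hq.inv, inv_pos.mpr h0, ?_⟩
      rw [map_neg, toMul_neg]
      exact Units.inv_eq_of_mul_eq_one_right
        (by rw [e, ← map_mul, kap_mul_kap_inv hq h0.ne', map_one])
  obtain ⟨q, hq, hq0, e⟩ := key _ h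
  refine ⟨q, hq, hq0, hι ?_⟩
  rw [map_mul, ← e, ← hΦ m₁, ← hΦ m₂, map_sub, toMul_sub, ← Units.val_mul, div_mul_cancel]

/-! ## §2 The extra pair `g₁₂` from `DasGapTwelve` -/

/-- **The `g₁₂` pair holds in `P` under `DasGapTwelve`**: `β(1/12,1/4) = κ(c₀)·β(1/4,1/4)`, with
`c₀ = 2^{−1/4}·3^{3/8}·√(1+√3)` the constant of `DasGapTwelveNegative` (`c₀_pos`, `isAlgebraic_c₀`).
[cite: Das2000] -/
theorem betaClass_twelfth_quarter (hDas : DasGapTwelve) :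
    betaClass (1 / 12) (1 / 4) = kap c₀ isAlgebraic_c₀ * betaClass (1 / 4) (1 / 4) := by
  have h12 : (0:ℚ) < 1 / 12 := by norm_num
  have h4 : (0:ℚ) < 1 / 4 := by norm_num
  set r : IntegralRep 1 := betaRep (1 / 12) (1 / 4) h12 h4 with hr
  set r' : IntegralRep 1 := (betaRep (1 / 4) (1 / 4) h4 h4).constMul c₀ isAlgebraic_c₀ with hr'
  have hEq : Equivalent r r' := by
    refine hDas r r' rfl ?_ rfl ?_
    · intro x _
      rw [hr, betaRep_integrand]
      simp only [betaKernel]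
      push_cast
      norm_num
    · intro x _
      rw [hr', IntegralRep.integrand_constMul, betaRep_integrand]
      simp only [betaKernel, c₀]
      push_cast
      norm_num
      ring
  rw [betaClass_eq _ _ h12 h4, hEq.toFormalPeriod_eq, hr', toFormalPeriod_of_constMul,
    ← betaClass_eq _ _ h4 h4]

/-- `IsConstMultiple` form of the `g₁₂` pair. [folklore] -/
theorem isConstMultiple_dasPair (hDas : DasGapTwelve) :
    IsConstMultiple (prodClass {((1:ℚ) / 12, (1:ℚ) / 4)}) (prodClass {((1:ℚ) / 4, (1:ℚ) / 4)}) := by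
  rw [prodClass_singleton, prodClass_singleton]
  exact ⟨c₀, isAlgebraic_c₀, c₀_pos, betaClass_twelfth_quarter hDas⟩

/-! ## §3 The compiler -/

/-- `RelSpan ⊔ ℤ·g₁₂` lies in the span of the compiler pairs (the standard pairs and the `g₁₂`
pair). [folklore] -/
theorem relSpan_sup_le :
    RelSpan ⊔ AddSubgroup.zmultiples (bsym (1 / 12) (1 / 4) - bsym (1 / 4) (1 / 4)) ≤
      AddSubgroup.closure ((fun p => msym p.1 - msym p.2) ''
        (relatorPairs ∪ {(({((1:ℚ) / 12, (1:ℚ) / 4)} : Multiset (ℚ × ℚ)), ({((1:ℚ) / 4, (1:ℚ) / 4)} : Multiset (ℚ × ℚ)))})) := by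
  refine sup_le (AddSubgroup.closure_mono (Set.image_mono subset_union_left)) ?_
  rw [AddSubgroup.zmultiples_le]
  refine AddSubgroup.subset_closure
    ⟨(({((1:ℚ) / 12, (1:ℚ) / 4)} : Multiset (ℚ × ℚ)), ({((1:ℚ) / 4, (1:ℚ) / 4)} : Multiset (ℚ × ℚ))),
      Or.inr rfl, ?_⟩
  simp [msym_singleton]

/-- The standard relator pairs hold in `P` up to positive constants, given the five chain facts
(symmetry, translation, unit, Dirichlet re-association, reflection) and Gauss multiplication.
[cite: AndrewsAskeyRoy1999, Thm 1.8.1] -/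
theorem isConstMultiple_of_mem_relatorPairs
    (hsymm : ∀ a b : ℚ, 0 < a → 0 < b → betaClass a b = betaClass b a)
    (htrans : ∀ a b : ℚ, 0 < a → 0 < b → IsConstMultiple (betaClass a b) (betaClass (a + 1) b))
    (hunit : betaClass 1 1 = 1)
    (hdir : ∀ a b c : ℚ, 0 < a → 0 < b → 0 < c →
      betaClass a b * betaClass (a + b) c = betaClass b c * betaClass a (b + c))
    (hrefl : ∀ a : ℚ, 0 < a → a < 1 →
      IsConstMultiple (betaClass a (1 - a)) (betaClass (1 / 2) (1 / 2)))
    (hmult : ∀ (n : ℕ) (s : ℚ), 2 ≤ n → 0 < s →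
      IsConstMultiple (prodClass (multL n s)) (prodClass (multR n s)))
    (p : Multiset (ℚ × ℚ) × Multiset (ℚ × ℚ)) (hp : p ∈ relatorPairs) :
    IsConstMultiple (prodClass p.1) (prodClass p.2) := by
  simp only [relatorPairs, Set.mem_union, Set.mem_setOf_eq, Set.mem_singleton_iff] at hp
  rcases hp with ((((hp | hp) | hp) | hp) | hp) | hp
  · obtain ⟨a, b, ha, hb, rfl⟩ := hp
    simp only [prodClass_singleton]
    exact isConstMultiple_of_eq (hsymm a b ha hb)
  · obtain ⟨a, b, ha, hb, rfl⟩ := hp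
    simp only [prodClass_singleton]
    exact htrans a b ha hb
  · obtain ⟨a, b, c, ha, hb, hc, rfl⟩ := hp
    refine isConstMultiple_of_eq ?_
    simp only [Multiset.insert_eq_cons, prodClass_cons, prodClass_singleton]
    exact hdir a b c ha hb hc
  · obtain ⟨n, s, hn, hs, rfl⟩ := hp
    exact hmult n s hn hs
  · obtain ⟨a, ha, ha1, rfl⟩ := hp
    simp only [prodClass_singleton]
    exact hrefl a ha ha1
  · subst hp
    refine isConstMultiple_of_eq ?_
    simp only [prodClass_singleton, prodClass_zero]
    exact hunit

/-- **The relator compiler, modulo the product bookkeeping.** Hypotheses: the cube and the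
ball×cube product bookkeeping in `P`, and Gauss multiplication in `P` from `MultiplicationAccessible`
(= the registered stub `stub_products` of the `GammaHodgeSector` line `koblitz-ogus-halving`, split
into its three conjuncts); the five one/two-letter relator chains come from the Chains file.
Conclusion: the route item `GammaHodgeFromRelators`. [folklore] -/
theorem gammaHodgeFromRelators_of
    (hcube : ∀ ⦃N : ℕ⦄ (x y : Fin N → ℚ) (r : IntegralRep N), (∀ j, 0 < x j ∧ 0 < y j) →
      IsCubeBetaRep x y r → toFormalPeriod (of r) = ∏ j, betaClass (x j) (y j))
    (hball : ∀ ⦃N' : ℕ⦄ (k : ℕ) (x' y' : Fin N' → ℚ) (c : ℝ) (hc : IsAlgebraic ℚ c)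
      (r' : IntegralRep (2 * k + N')), (∀ l, 0 < x' l ∧ 0 < y' l) → IsBallCubeRep k x' y' c r' →
      toFormalPeriod (of r') = kap c hc * betaClass (1 / 2) (1 / 2) ^ k * ∏ l, betaClass (x' l) (y' l))
    (hmult : MultiplicationAccessible → ∀ (n : ℕ) (s : ℚ), 2 ≤ n → 0 < s →
      IsConstMultiple (prodClass (multL n s)) (prodClass (multR n s))) :
    GammaHodgeFromRelators := by
  intro hM hB hDas hGap hEuler N N' k x y x' y' c hx hx' hH hc r r' hd hi hd' hi' hv
  by_cases hmem : wordSym x y - wordSym x' y' - k • bsym (1 / 2) (1 / 2) ∈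
      RelSpan ⊔ AddSubgroup.zmultiples (bsym (1 / 12) (1 / 4) - bsym (1 / 4) (1 / 4))
  swap
  · exact hGap N N' k x y x' y' c hx hx' hH hc hmem r r' hd hi hd' hi' hv
  have hpos : ∀ j, 0 < x j ∧ 0 < y j := fun j => ⟨(hx j).1, (hx j).2.1⟩
  have hpos' : ∀ l, 0 < x' l ∧ 0 < y' l := fun l => ⟨(hx' l).1, (hx' l).2.1⟩
  -- the two Beta words
  set m₁ : Multiset (ℚ × ℚ) := wordMultiset x y with hm₁
  set m₂ : Multiset (ℚ × ℚ) := wordMultiset x' y' + k • ({((1:ℚ) / 2, (1:ℚ) / 2)} : Multiset (ℚ × ℚ))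
    with hm₂
  have hsym : msym m₁ - msym m₂ = wordSym x y - wordSym x' y' - k • bsym (1 / 2) (1 / 2) := by
    simp only [hm₁, hm₂, msym_add, msym_nsmul, msym_singleton, msym_wordMultiset]
    abel
  have hP₂ : prodClass m₂ = betaClass (1 / 2) (1 / 2) ^ k * ∏ l, betaClass (x' l) (y' l) := by
    rw [hm₂, prodClass_add, prodClass_nsmul, prodClass_singleton, prodClass_wordMultiset, mul_comm]
  -- realisation over the compiler pairs
  have hreal : IsConstMultiple (prodClass m₁) (prodClass m₂) := by
    refine realisation_of hB
      (relatorPairs ∪ {(({((1:ℚ) / 12, (1:ℚ) / 4)} : Multiset (ℚ × ℚ)), ({((1:ℚ) / 4, (1:ℚ) / 4)} : Multiset (ℚ × ℚ)))}) ?_ m₁ m₂ ?_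
    · rintro p (hp | hp)
      · exact isConstMultiple_of_mem_relatorPairs betaClass_symm isConstMultiple_betaClass_transl
          betaClass_one_one betaClass_reassoc (isConstMultiple_betaClass_refl hEuler) (hmult hM) p hp
      · rw [Set.mem_singleton_iff] at hp
        subst hp
        exact isConstMultiple_dasPair hDas
    · rw [hsym]
      exact relSpan_sup_le hmem
  obtain ⟨q, hq, hq0, hqeq⟩ := hreal
  -- the two representations in `P`
  have h1 : toFormalPeriod (of r) = kap q hq * prodClass m₂ := by
    rw [← hqeq, hm₁, prodClass_wordMultiset]
    exact hcube x y r hpos ⟨hd, hi⟩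
  have h2 : toFormalPeriod (of r') = kap c hc * prodClass m₂ := by
    rw [hP₂, ← mul_assoc]
    exact hball k x' y' c hc r' hpos' ⟨hd', hi'⟩
  -- evaluation pins the constant
  have hE : 0 < evalP (prodClass m₂) := by
    rw [hP₂, map_mul]
    exact mul_pos (evalP_betaHalf_pow_pos k) (evalP_prod_betaClass_pos x' y' hpos')
  have e1 := congrArg evalP h1
  have e2 := congrArg evalP h2
  rw [evalP_toFormalPeriod_of, map_mul, evalP_kap] at e1 e2
  rw [hv] at e1
  have hqc : q = c := mul_right_cancel₀ hE.ne' (e1.symm.trans e2)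
  have h3 : toFormalPeriod (of r) = toFormalPeriod (of r') := by
    rw [h1, h2, kap_congr hq hc hqc]
  exact toFormalPeriod_eq_iff.mp h3

/-- **`GammaHodgeFromRelators` holds** (item stmt-KontsevichZagierPeriods-14947 of route
TerasomaMultiplication): the relator compiler `gammaHodgeFromRelators_of` fed with the three
conjuncts of the landed product bookkeeping `GammaHodgeSectorKO.stub_products` (cube classes,
ball × cube class, Gauss multiplication in `P` from `MultiplicationAccessible`). [folklore] -/
theorem gammaHodgeFromRelators_proof : GammaHodgeFromRelators :=
  gammaHodgeFromRelators_of stub_products.1 stub_products.2.1 stub_products.2.2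

end Summit.KontsevichZagierPeriods.TerasomaMultiplication.GammaHodgeFromRelators

end
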